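import Mathlib
import Summits.Ventures.PercRepro2.SepGlueGen

/-!
# Gluing at a general separator, II: the mark `a₃` alone behind a separator `σ : ι → V` — the typed
one-far-`a₃` rule at a separator of any size (blind cell PercRepro2, mine-2 g47, 2026-08-29;
`conjectures/MINE-2.md` M2-97)

CLASS (`SepFarA3G`): the support graph `z ∪ F` splits into a root side `VH ∋ o, a₁, a₂, b` and a far
side `VL ∋ a₃` whose intersection is covered by the separator vertices `σ i` (marks may be separator
vertices; `a₃` may not), no typed edge inside both sides.  The state of a copy is a function of its
ROOT-SIDE DATA — the connections inside `VH` among the root marks and the separator vertices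
(`rootDataG`) — and of its FAR PATTERN (`fpG`: the far connections among the separator vertices and
from them to `a₃`): the GLUE relation (the closure of «joined inside `VH` or inside `VL`» on `ι`)
merges root-side clusters, and `a₃` hangs from the root side through a glued separator vertex
(`st_eq_gluedG`, by `conn_sideG` / `conn_crossG`).  Sorting the copies by their pattern triple,

  **`typedCount F z τ K₃ = (Σ_p farCount(p) · rootCount(p)) · (inert count)`**

(`typedCount_eq_sepFarA3G`), and since the far counts are copy-symmetric, **row 2′TRI on the class
follows once every REALISED `S₃`-orbit sum of the root counts is nonnegative**
(`typedCount_nonneg_of_sepFarA3G_realised`; the abstract rule `nonneg_of_orbit_sumsG`).  The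
2-separator rule `TwoSepFarRule.typedCount_nonneg_of_sep2FarA3_realised` is the case `ι = Fin 2`
(with the one-hop glue written out), the cut-vertex rule `CutFarA3` the case `ι = Unit`; here the
separator has any finite size and the glue relation is the genuine closure.  Own work; standard
axioms.
-/

namespace Summit.Ventures.PercRepro2

open UnionCluster

namespace CovForm

namespace RootBridge

open OneTyped TypedA3 Untouched TypedFactor Separated

/-! ## The root-side data and the glued state -/

section States

open Classical

variable {ι : Type*}

/-- The root-side data of a copy at a separator indexed by `ι`: the connections inside the root
side among the root-side marks, from the separator vertices to the root-side marks, and among the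
separator vertices. -/
structure RootDataG (ι : Type*) where
  /-- `a₂ ↔ a₁` -/
  q' : Bool
  /-- `a₁ ↔ o` -/
  Lo : Bool
  /-- `a₂ ↔ o` -/
  Ho : Bool
  /-- `a₁ ↔ b` -/
  Lb : Bool
  /-- `a₂ ↔ b` -/
  Hb : Bool
  /-- `σ i ↔ a₁` -/
  L : ι → Bool
  /-- `σ i ↔ a₂` -/
  H : ι → Bool
  /-- `σ i ↔ o` -/
  O : ι → Bool
  /-- `σ i ↔ b` -/
  B : ι → Bool
  /-- `σ i ↔ σ j` -/
  S : ι → ι → Bool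

/-- The glue relation read off the data: the closure of «joined inside the root side or inside
the far side». -/
def glueD (h : RootDataG ι) (p : FPG ι) (i j : ι) : Prop :=
  Relation.ReflTransGen (fun i j => h.S i j = true ∨ p.1 i j = true) i j

/-- **The glued state**: the root-side data `h` glued with the far pattern `p`.  A root-side
connection `r ↔ u` holds directly or through a glued pair of separator vertices; `a₃` is reached
through a separator vertex glued to one that the far side joins to `a₃`. -/
noncomputable def gluedG (h : RootDataG ι) (p : FPG ι) : St :=
  (h.q' || decide (∃ i j, h.H i = true ∧ glueD h p i j ∧ h.L j = true),
   h.Lo || decide (∃ i j, h.L i = true ∧ glueD h p i j ∧ h.O j = true),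
   h.Ho || decide (∃ i j, h.H i = true ∧ glueD h p i j ∧ h.O j = true),
   h.Lb || decide (∃ i j, h.L i = true ∧ glueD h p i j ∧ h.B j = true),
   h.Hb || decide (∃ i j, h.H i = true ∧ glueD h p i j ∧ h.B j = true),
   decide (∃ i j, h.L i = true ∧ glueD h p i j ∧ p.2 j = true),
   decide (∃ i j, h.H i = true ∧ glueD h p i j ∧ p.2 j = true))

end States

/-! ## The class, the states of the support and the identity -/

section Main

open Classical

variable {V : Type*} {E : Type*} {ι : Type*} [Fintype E] [DecidableEq E] {R : Type*} [Field R]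
  [LinearOrder R] [IsStrictOrderedRing R]
variable (ends : E → Sym2 V) (o a₁ a₂ a₃ b : V) (σ : ι → V)

/-- The root-side data of a configuration (read on the root-side restriction). -/
noncomputable def rootDataG (y : Config E) : RootDataG ι :=
  ⟨decide (Conn ends y a₂ a₁), decide (Conn ends y a₁ o), decide (Conn ends y a₂ o),
    decide (Conn ends y a₁ b), decide (Conn ends y a₂ b),
    fun i => decide (Conn ends y (σ i) a₁), fun i => decide (Conn ends y (σ i) a₂),
    fun i => decide (Conn ends y (σ i) o), fun i => decide (Conn ends y (σ i) b),
    fun i j => decide (Conn ends y (σ i) (σ j))⟩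

/-- **`a₃` alone behind the separator `σ`**: the support graph `z ∪ F` splits into a root side
`VH ∋ o, a₁, a₂, b` and a far side `VL ∋ a₃` whose intersection is covered by the separator
vertices, no typed edge inside both sides, `a₃` not a separator vertex. -/
structure SepFarA3G (VL VH : Set V) (F : Finset E) (z : Config E) : Prop where
  split : ∀ e, zF F z e = true → e ∈ within ends VL ∨ e ∈ within ends VH
  cap : ∀ t, t ∈ VL → t ∈ VH → ∃ i, σ i = t
  noloop : ∀ e ∈ F, ¬ (e ∈ within ends VL ∧ e ∈ within ends VH)
  oH : o ∈ VH
  a1H : a₁ ∈ VH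
  a2H : a₂ ∈ VH
  bH : b ∈ VH
  a3L : a₃ ∈ VL
  a3sep : ∀ i, σ i ≠ a₃

omit [Fintype E] [LinearOrder R] [IsStrictOrderedRing R] in
/-- A configuration below `z ∪ F` has its open edges within a side. -/
lemma SepFarA3G.split_of_le {VL VH : Set V} {F : Finset E} {z : Config E}
    (h : SepFarA3G ends o a₁ a₂ a₃ b σ VL VH F z) {x : Config E} (hx : x ≤ zF F z) :
    ∀ e, x e = true → e ∈ within ends VL ∨ e ∈ within ends VH := fun e he =>
  h.split e (by have := hx e; rw [he] at this; exact Bool.eq_true_of_true_le this)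

omit [Fintype E] [DecidableEq E] [LinearOrder R] [IsStrictOrderedRing R] in
/-- The glue relation of the sides is the glue relation of the data. -/
lemma glue_iff_glueD (VL VH : Set V) (x : Config E) (i j : ι) :
    glue ends VH VL σ x i j ↔
      glueD (rootDataG ends o a₁ a₂ b σ (withinRestr ends VH x))
        (fpG ends σ a₃ (withinRestr ends VL x)) i j := by
  unfold glue glueD
  have hrel : sepStep ends VH VL σ x = fun i j =>
      (rootDataG ends o a₁ a₂ b σ (withinRestr ends VH x)).S i j = true ∨
        (fpG ends σ a₃ (withinRestr ends VL x)).1 i j = true := by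
    funext i j
    simp only [sepStep, rootDataG, fpG, decide_eq_true_eq]
  rw [hrel]

omit [Fintype E] [LinearOrder R] [IsStrictOrderedRing R] in
/-- **The state of a copy of the support**: the root-side data glued with the far pattern. -/
theorem st_eq_gluedG {VL VH : Set V} {F : Finset E} {z : Config E}
    (h : SepFarA3G ends o a₁ a₂ a₃ b σ VL VH F z) {x : Config E}
    (hx : ∀ e, e ∉ F → x e = z e) :
    st ends o a₁ a₂ a₃ b x =
      gluedG (rootDataG ends o a₁ a₂ b σ (withinRestr ends VH x))
        (fpG ends σ a₃ (withinRestr ends VL x)) := by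
  have hsp := SepFarA3G.split_of_le ends o a₁ a₂ a₃ b σ h (le_zF hx)
  have hsp' : ∀ e, x e = true → e ∈ within ends VH ∨ e ∈ within ends VL := fun e he =>
    (hsp e he).symm
  have hcap' : ∀ t, t ∈ VH → t ∈ VL → ∃ i, σ i = t := fun t h1 h2 => h.cap t h2 h1
  have hg := glue_iff_glueD ends o a₁ a₂ a₃ b σ VL VH x
  have e1 := conn_sideG ends hsp' hcap' h.a2H h.a1H
  have e2 := conn_sideG ends hsp' hcap' h.a1H h.oH
  have e3 := conn_sideG ends hsp' hcap' h.a2H h.oH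
  have e4 := conn_sideG ends hsp' hcap' h.a1H h.bH
  have e5 := conn_sideG ends hsp' hcap' h.a2H h.bH
  have e6 := conn_crossG ends hsp' hcap' h.a1H h.a3L h.a3sep
  have e7 := conn_crossG ends hsp' hcap' h.a2H h.a3L h.a3sep
  unfold st gluedG
  rw [decide_eq_decide.mpr e1, decide_eq_decide.mpr e2, decide_eq_decide.mpr e3,
    decide_eq_decide.mpr e4, decide_eq_decide.mpr e5, decide_eq_decide.mpr e6,
    decide_eq_decide.mpr e7]
  · simp only [reachG, reachG', hg, rootDataG, fpG, Bool.decide_or, decide_eq_true_eq]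
  all_goals infer_instance

/-- The root-side kernel of a fixed pattern triple `p`: the kernel on the glued states of the three
copies, read on the root-side restriction. -/
noncomputable def rootKG (VH : Set V) (p : Pat3G ι) : Config E → Config E → Config E → R :=
  fun x y w => ((KB (gluedG (rootDataG ends o a₁ a₂ b σ (withinRestr ends VH x)) p.1)
    (gluedG (rootDataG ends o a₁ a₂ b σ (withinRestr ends VH y)) p.2.1)
    (gluedG (rootDataG ends o a₁ a₂ b σ (withinRestr ends VH w)) p.2.2) : ℤ) : R)

omit [Fintype E] [LinearOrder R] [IsStrictOrderedRing R] in
/-- **`K₃` on the support** when `a₃` alone sits beyond the separator: the pattern-triple form. -/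
theorem K3_eq_sepFarA3G [Fintype ι] [DecidableEq ι] {VL VH : Set V} {F : Finset E}
    {z : Config E} (h : SepFarA3G ends o a₁ a₂ a₃ b σ VL VH F z) {x y w : Config E}
    (hx : ∀ e, e ∉ F → x e = z e) (hy : ∀ e, e ∉ F → y e = z e) (hw : ∀ e, e ∉ F → w e = z e) :
    (K3 ends o a₁ a₂ a₃ b x y w : R) =
      ∑ p : Pat3G ι, farKG ends σ a₃ VL p (restr (sideF ends VL F) z x)
          (restr (sideF ends VL F) z y) (restr (sideF ends VL F) z w) *
        rootKG ends o a₁ a₂ b σ VH p (restr (sideF ends VH F) z x) (restr (sideF ends VH F) z y)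
          (restr (sideF ends VH F) z w) := by
  rw [K3_eq_KB, st_eq_gluedG ends o a₁ a₂ a₃ b σ h hx, st_eq_gluedG ends o a₁ a₂ a₃ b σ h hy,
    st_eq_gluedG ends o a₁ a₂ a₃ b σ h hw]
  unfold farKG rootKG
  rw [withinRestr_restr_eq ends VH hx, withinRestr_restr_eq ends VH hy,
    withinRestr_restr_eq ends VH hw, withinRestr_restr_eq ends VL hx,
    withinRestr_restr_eq ends VL hy, withinRestr_restr_eq ends VL hw]
  set hx' := rootDataG ends o a₁ a₂ b σ (withinRestr ends VH x) with hhx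
  set hy' := rootDataG ends o a₁ a₂ b σ (withinRestr ends VH y) with hhy
  set hw' := rootDataG ends o a₁ a₂ b σ (withinRestr ends VH w) with hhw
  set qx := fpG ends σ a₃ (withinRestr ends VL x) with hqx
  set qy := fpG ends σ a₃ (withinRestr ends VL y) with hqy
  set qw := fpG ends σ a₃ (withinRestr ends VL w) with hqw
  have hs : (∑ p : Pat3G ι, exactG p.1 qx * exactG p.2.1 qy * exactG p.2.2 qw *
      KB (gluedG hx' p.1) (gluedG hy' p.2.1) (gluedG hw' p.2.2)) =
      KB (gluedG hx' qx) (gluedG hy' qy) (gluedG hw' qw) :=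
    sum_exactG (fun p : Pat3G ι => KB (gluedG hx' p.1) (gluedG hy' p.2.1) (gluedG hw' p.2.2))
      (qx, qy, qw)
  rw [← hs]
  push_cast
  rfl

omit [LinearOrder R] [IsStrictOrderedRing R] in
/-- **THE TYPED ONE-FAR-`a₃` RULE AT A SEPARATOR OF ANY SIZE**: sorting the copies by their
far-pattern triple, `typedCount F z τ K₃ = (Σ_p farCount(p) · rootCount(p)) · (inert count)`. -/
theorem typedCount_eq_sepFarA3G [Fintype ι] [DecidableEq ι] {VL VH : Set V} (F : Finset E)
    (z : Config E) (τ : E → ℕ) (h : SepFarA3G ends o a₁ a₂ a₃ b σ VL VH F z) :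
    typedCount F z τ (K3 ends o a₁ a₂ a₃ b : Config E → Config E → Config E → R) =
      (∑ p : Pat3G ι, typedCount (sideF ends VL F) z τ (farKG ends σ a₃ VL p) *
          typedCount (sideF ends VH F) z τ (rootKG ends o a₁ a₂ b σ VH p)) *
        typedCount (F \ (sideF ends VL F ∪ sideF ends VH F)) z τ (fun _ _ _ => (1 : R)) := by
  set A := sideF ends VL F with hA
  set B := sideF ends VH F with hB
  set C := F \ (A ∪ B) with hC
  have hAF : A ⊆ F := Finset.filter_subset _ _
  have hBF : B ⊆ F := Finset.filter_subset _ _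
  have hAB : Disjoint A B := by
    rw [Finset.disjoint_left]
    intro e heA heB
    simp only [hA, hB, sideF, Finset.mem_filter] at heA heB
    exact h.noloop e heA.1 ⟨heA.2, heB.2⟩
  have hABF : A ∪ B ⊆ F := Finset.union_subset hAF hBF
  have hAC : Disjoint A C :=
    Finset.disjoint_of_subset_left Finset.subset_union_left Finset.disjoint_sdiff
  have hBC : Disjoint B C :=
    Finset.disjoint_of_subset_left Finset.subset_union_right Finset.disjoint_sdiff
  have hF : A ∪ B ∪ C = F := Finset.union_sdiff_of_subset hABF
  have hker : typedCount F z τ (K3 ends o a₁ a₂ a₃ b : Config E → Config E → Config E → R) =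
      typedCount F z τ (fun x y w => ∑ p : Pat3G ι,
        farKG ends σ a₃ VL p (restr A z x) (restr A z y) (restr A z w) *
          rootKG ends o a₁ a₂ b σ VH p (restr B z x) (restr B z y) (restr B z w)) := by
    refine typedCount_congr_on_support F z τ fun x y w hc _ => ?_
    exact K3_eq_sepFarA3G ends o a₁ a₂ a₃ b σ h (fun e he => (hc e he).1)
      (fun e he => (hc e he).2.1) (fun e he => (hc e he).2.2)
  have hm : ∀ p : Pat3G ι, typedCount (A ∪ B ∪ C) z τ (fun x y w =>
      farKG ends σ a₃ VL p (restr A z x) (restr A z y) (restr A z w) *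
        rootKG ends o a₁ a₂ b σ VH p (restr B z x) (restr B z y) (restr B z w)) =
      typedCount A z τ (farKG ends σ a₃ VL p) *
        typedCount B z τ (rootKG ends o a₁ a₂ b σ VH p) *
        typedCount C z τ (fun _ _ _ => (1 : R)) := fun p =>
    typedCount_mul_three A B C hAB hAC hBC z τ (farKG ends σ a₃ VL p)
      (rootKG ends o a₁ a₂ b σ VH p : Config E → Config E → Config E → R)
  rw [hF] at hm
  rw [hker, typedCount_sum, Finset.sum_congr rfl (fun p _ => hm p), Finset.sum_mul]

end Main

/-! ## The abstract rule on a general pattern type, and the rule on the realised orbits -/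

section Rule

open Classical

variable {R : Type*} [Field R] [LinearOrder R] [IsStrictOrderedRing R]

/-- The `S₃`-orbit sum of a function on triples. -/
def orbitSumG {P : Type*} (h : P × P × P → R) (p : P × P × P) : R :=
  h p + h (p.2.1, p.1, p.2.2) + h (p.1, p.2.2, p.2.1) + h (p.2.2, p.2.1, p.1) +
    h (p.2.1, p.2.2, p.1) + h (p.2.2, p.1, p.2.1)

/-- **The abstract rule** on any finite pattern type: a nonnegative weight `l` whose pairing with
`h` is invariant under the six copy permutations of `h` pairs nonnegatively with `h` as soon as the
orbit sums of `h` are nonnegative wherever `l` is nonzero. -/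
theorem nonneg_of_orbit_sumsG {P : Type*} [Fintype P] (l h : P × P × P → R)
    (hl : ∀ p, 0 ≤ l p)
    (h12 : (∑ p : P × P × P, l p * h (p.2.1, p.1, p.2.2)) = ∑ p : P × P × P, l p * h p)
    (h23 : (∑ p : P × P × P, l p * h (p.1, p.2.2, p.2.1)) = ∑ p : P × P × P, l p * h p)
    (h13 : (∑ p : P × P × P, l p * h (p.2.2, p.2.1, p.1)) = ∑ p : P × P × P, l p * h p)
    (hc : (∑ p : P × P × P, l p * h (p.2.1, p.2.2, p.1)) = ∑ p : P × P × P, l p * h p)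
    (hc' : (∑ p : P × P × P, l p * h (p.2.2, p.1, p.2.1)) = ∑ p : P × P × P, l p * h p)
    (hH : ∀ p, l p ≠ 0 → 0 ≤ orbitSumG h p) :
    0 ≤ ∑ p : P × P × P, l p * h p := by
  have h6 : (6 : R) * (∑ p : P × P × P, l p * h p) = ∑ p : P × P × P, l p * orbitSumG h p := by
    unfold orbitSumG
    simp only [mul_add, Finset.sum_add_distrib]
    rw [h12, h23, h13, hc, hc']
    ring
  have hpos : (0 : R) ≤ ∑ p : P × P × P, l p * orbitSumG h p := by
    refine Finset.sum_nonneg fun p _ => ?_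
    by_cases hz : l p = 0
    · rw [hz, zero_mul]
    · exact mul_nonneg (hl p) (hH p hz)
  rw [← h6] at hpos
  exact (mul_nonneg_iff_of_pos_left (by norm_num : (0 : R) < 6)).mp hpos

variable {V : Type*} {E : Type*} {ι : Type*} [Fintype E] [DecidableEq E] [Fintype ι]
  [DecidableEq ι]
variable (ends : E → Sym2 V) (o a₁ a₂ a₃ b : V) (σ : ι → V)

/-- The `S₃`-orbit sum of the root-side counts of a pattern triple (the six copy permutations). -/
noncomputable def orbitRootG (VH : Set V) (B : Finset E) (z : Config E) (τ : E → ℕ)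
    (p : Pat3G ι) : R :=
  orbitSumG (fun q => typedCount B z τ (rootKG ends o a₁ a₂ b σ VH q)) p

omit [LinearOrder R] [IsStrictOrderedRing R] in
/-- Pairing the far counts with a permuted root count gives the same sum (the far counts are
copy-symmetric, the permutation a bijection of the pattern triples). -/
lemma sum_far_root_permG (VL VH : Set V) (A B : Finset E) (z : Config E) (τ : E → ℕ)
    (f : Pat3G ι → Pat3G ι) (hf : Function.Bijective f)
    (hσ : ∀ p, typedCount A z τ (farKG ends σ a₃ VL (f p) : Config E → Config E → Config E → R) =
      typedCount A z τ (farKG ends σ a₃ VL p)) :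
    (∑ p : Pat3G ι, typedCount A z τ (farKG ends σ a₃ VL p : Config E → Config E → Config E → R) *
        typedCount B z τ (rootKG ends o a₁ a₂ b σ VH (f p))) =
      ∑ p : Pat3G ι, typedCount A z τ (farKG ends σ a₃ VL p : Config E → Config E → Config E → R) *
        typedCount B z τ (rootKG ends o a₁ a₂ b σ VH p) := by
  refine Fintype.sum_bijective f hf _ _ fun p => ?_
  rw [hσ p]

/-- **Row 2′TRI when `a₃` sits alone behind a separator of any size, from the REALISED orbits**:
it suffices that the `S₃`-orbit sums of the root-side counts be nonnegative on the pattern triples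
whose far count is nonzero. -/
theorem typedCount_nonneg_of_sepFarA3G_realised {VL VH : Set V} (F : Finset E) (z : Config E)
    (τ : E → ℕ) (hτ : ∀ e ∈ F, τ e = 1 ∨ τ e = 2)
    (h : SepFarA3G ends o a₁ a₂ a₃ b σ VL VH F z)
    (hroot : ∀ p : Pat3G ι,
      typedCount (sideF ends VL F) z τ (farKG ends σ a₃ VL p : Config E → Config E → Config E → R) ≠ 0 →
      (0 : R) ≤ orbitRootG ends o a₁ a₂ b σ VH (sideF ends VH F) z τ p) :
    0 ≤ typedCount F z τ (K3 ends o a₁ a₂ a₃ b : Config E → Config E → Config E → R) := by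
  rw [typedCount_eq_sepFarA3G ends o a₁ a₂ a₃ b σ F z τ h]
  have hτA : ∀ e ∈ sideF ends VL F, τ e = 1 ∨ τ e = 2 := fun e he => hτ e (Finset.filter_subset _ _ he)
  refine mul_nonneg ?_ (typedCount_nonneg_of_nonneg _ _ _ fun _ _ _ => zero_le_one)
  refine nonneg_of_orbit_sumsG (fun p => typedCount (sideF ends VL F) z τ (farKG ends σ a₃ VL p))
    (fun p => typedCount (sideF ends VH F) z τ (rootKG ends o a₁ a₂ b σ VH p))
    (fun p => farCountG_nonneg ends σ a₃ VL _ z τ p) ?_ ?_ ?_ ?_ ?_ hroot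
  · exact sum_far_root_permG ends o a₁ a₂ a₃ b σ VL VH _ _ z τ _
      (Function.Involutive.bijective fun _ => rfl) (fun p => farCountG_swap12 ends σ a₃ VL _ z τ p)
  · exact sum_far_root_permG ends o a₁ a₂ a₃ b σ VL VH _ _ z τ _
      (Function.Involutive.bijective fun _ => rfl)
      (fun p => farCountG_swap23 ends σ a₃ VL _ z τ hτA p)
  · exact sum_far_root_permG ends o a₁ a₂ a₃ b σ VL VH _ _ z τ _
      (Function.Involutive.bijective fun _ => rfl)
      (fun p => farCountG_swap13 ends σ a₃ VL _ z τ hτA p)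
  · exact sum_far_root_permG ends o a₁ a₂ a₃ b σ VL VH _ _ z τ _
      (Function.bijective_iff_has_inverse.mpr ⟨fun p => (p.2.2, p.1, p.2.1), fun _ => rfl, fun _ => rfl⟩)
      (fun p => farCountG_cyc ends σ a₃ VL _ z τ hτA p)
  · exact sum_far_root_permG ends o a₁ a₂ a₃ b σ VL VH _ _ z τ _
      (Function.bijective_iff_has_inverse.mpr ⟨fun p => (p.2.1, p.2.2, p.1), fun _ => rfl, fun _ => rfl⟩)
      (fun p => farCountG_cyc' ends σ a₃ VL _ z τ hτA p)

end Rule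

end RootBridge

end CovForm

end Summit.Ventures.PercRepro2
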